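import Summits.AnomalousDissipation.AnomalousDissipation.Theorems.SolenoidalFractalHomogenisationLagrangianStepVmodFrameDefs
import Summits.AnomalousDissipation.AnomalousDissipation.Theorems.SolenoidalFractalHomogenisationLagrangianStepFrameModulationClosed
import Summits.AnomalousDissipation.AnomalousDissipation.Theorems.SolenoidalFractalHomogenisationLagrangianStepFrameRate
import Summits.AnomalousDissipation.AnomalousDissipation.Theorems.SolenoidalFractalHomogenisationLagrangianStepFrameGroupLaw
import Summits.AnomalousDissipation.AnomalousDissipation.Theorems.SolenoidalFractalHomogenisationLagrangianStepFrameConjugacyAssemblyCurve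
import HarnessLib

/-!
# K1L_D (stmt-AnomalousDissipation-27980), (ℓ3-A) road A: THE CLAMPED EXACT-FLOW FRAME IS A FRAME MODULATION (class of record) on the closed piece —
# `FrameForm.isFrameModulation_frameG_of_closed` / `isFrameModulation_frameG_closed_pos`
(helper, `--supports 27980 --as helper`; prover lead-k1l-onelevel-p1 g7; tenure RULING D28-10 (a).)

`FrameForm.isModulation_frameG_of_closed` / `Z7Glue.isModulation_frameG_closed_pos` (p704979 / p707880) with the conclusion UPGRADED to
`CellClauseMod.IsFrameModulation` for the CLAMPED curve `τ ↦ frameG E m (jR + clamp(τ)/a(m+1)) (jR)`: the `IsModulation` part transfers by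
`FrameConj.isModulation_congr_Icc`; `clamped` by idempotence of the clamp; `rate θ/Tw` from the adjugate's window-time Lipschitz constant `C = 3(1+θ)Cb`
(`norm_deriv_adjugate_le_closed` + mean value) and the budget `C·T ≤ θ` — the very constants of the `IsModulation` proof; `holonomic` with
`φ = E.disp m (jR + clamp(τ)/a) (jR)`: `frameG * frameJac = 1` (`frameG := frameJac⁻¹`, `FrameConj.isUnit_frameJac`), `frameJac = 1 + ∇disp`
(`LevelRegular.flowDeriv_single_apply`).  Same inputs and constants as the originals.
No sorry, no definition, no named fact.  NOT a proof of (M_θ), of `stub_Vmod_EHTthg`, of K1L_D or AD; rung F-D1.A0.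
-/

set_option linter.dupNamespace false

noncomputable section

namespace Summit.AnomalousDissipation.AnomalousDissipation.Theorems.SolenoidalFractalHomogenisation.LagrangianStep.FrameForm

open Set Function Filter
open scoped NNReal
open Literature.Analysis Literature.Analysis.ODE Literature.Analysis.FunctionSpaces Literature.Analysis.FunctionSpaces.Torus
open Literature.Analysis.FluidPDE Literature.Analysis.FluidPDE.LatticeShear
open Summit.AnomalousDissipation.AnomalousDissipation.Theorems.SolenoidalFractalHomogenisation.LagrangianCarrierConstruction
open Summit.AnomalousDissipation.AnomalousDissipation.Theorems.SolenoidalFractalHomogenisation.LagrangianCarrier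
open Summit.AnomalousDissipation.AnomalousDissipation.Theorems.SolenoidalFractalHomogenisation.LagrangianStep.CellClauseMod

variable {k : ℕ}

/-- The clamp is idempotent. -/
theorem clamp_clamp (τ Tw : ℝ) (hTw : 0 ≤ Tw) : max 0 (min (max 0 (min τ Tw)) Tw) = max 0 (min τ Tw) :=
  FrameConj.clamp_eq_self ⟨le_max_left _ _, max_le hTw (min_le_right _ _)⟩

/-- **The clamped exact-flow frame is a FRAME MODULATION on the closed piece** — `isModulation_frameG_of_closed` (same inputs `hnear`, `hrate`,
`hbudget`, `hpiola`, `hcurv`) with the conclusion upgraded to `IsFrameModulation` for the CLAMPED curve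
`τ ↦ frameG E m (jR + clamp(τ)/a) jR`: `clamped` by idempotence of the clamp; `rate θ/Tw` from the adjugate's window-time Lipschitz constant
`C = 3(1+θ)Cb` (`norm_deriv_adjugate_le_closed` + mean value) and the budget `C·T ≤ θ`; `holonomic` with `φ = E.disp m (jR + τ/a) jR`
(`frameG * frameJac = 1`, `frameJac = 1 + ∇disp`). -/
theorem isFrameModulation_frameG_of_closed (E : LagrangianLatticeCarrier k) (hR : E.LevelRegular) {m : ℕ} (hF : E.IsFlow m) (j : ℤ)
    {t : ℝ} (hst : (j : ℝ) * E.refresh (m + 1) < t) (htR : t - (j : ℝ) * E.refresh (m + 1) ≤ E.refresh (m + 1))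
    {θ nC Cb : ℝ} (hθ : 0 ≤ θ) (hCb : 0 ≤ Cb)
    (hnear : ∀ u ∈ Icc 0 (t - (j : ℝ) * E.refresh (m + 1)), ∀ (y : UnitAddTorus (Fin 3)) (i l : Fin 3),
      |frameG E m ((j : ℝ) * E.refresh (m + 1) + u) ((j : ℝ) * E.refresh (m + 1)) y i l - (1 : Matrix (Fin 3) (Fin 3) ℝ) i l| ≤ θ)
    (hrate : ∀ u ∈ Icc 0 (t - (j : ℝ) * E.refresh (m + 1)), ∀ (y : UnitAddTorus (Fin 3)) (a q : Fin 3),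
      |Torus.partialDeriv q (fun z => E.partialSum m ((j : ℝ) * E.refresh (m + 1) + u) z a)
        (E.X m ((j : ℝ) * E.refresh (m + 1) + u) ((j : ℝ) * E.refresh (m + 1)) y)| ≤ Cb)
    (hbudget : 3 * (1 + θ) * Cb * (t - (j : ℝ) * E.refresh (m + 1)) ≤ θ)
    (hpiola : ∀ u ∈ Icc 0 (t - (j : ℝ) * E.refresh (m + 1)), ∀ i : Fin 3,
      Torus.IsDivFree (fun y => (WithLp.toLp 2 fun c => frameG E m ((j : ℝ) * E.refresh (m + 1) + u) ((j : ℝ) * E.refresh (m + 1)) y c i :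
        EuclideanSpace ℝ (Fin 3))))
    (hcurv : ∀ u ∈ Icc 0 (t - (j : ℝ) * E.refresh (m + 1)), ∀ (y : UnitAddTorus (Fin 3)) (i l c : Fin 3),
      |Torus.partialDeriv c (fun y => frameG E m ((j : ℝ) * E.refresh (m + 1) + u) ((j : ℝ) * E.refresh (m + 1)) y i l) y| ≤ θ * nC) :
    IsFrameModulation θ (E.a (m + 1) * (t - (j : ℝ) * E.refresh (m + 1))) nC
      (fun τ y => frameG E m ((j : ℝ) * E.refresh (m + 1)
        + max 0 (min τ (E.a (m + 1) * (t - (j : ℝ) * E.refresh (m + 1)))) / E.a (m + 1)) ((j : ℝ) * E.refresh (m + 1)) y) := by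
  set s : ℝ := (j : ℝ) * E.refresh (m + 1) with hs
  set T : ℝ := t - s with hTdef
  set a : ℝ := E.a (m + 1) with ha
  have ha0 : 0 < a := E.toFractalCarrierData.a_pos (m + 1)
  have hT0 : 0 < T := by rw [hTdef]; linarith
  have hTR : T ≤ E.refresh (m + 1) := htR
  have haT : 0 < a * T := mul_pos ha0 hT0
  have hmem : ∀ τ ∈ Icc 0 (a * T), τ / a ∈ Icc 0 T := by
    intro τ hτ
    refine ⟨div_nonneg hτ.1 ha0.le, ?_⟩
    rw [div_le_iff₀ ha0]; linarith [hτ.2, mul_comm a T]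
  have hclampI : ∀ τ : ℝ, max 0 (min τ (a * T)) ∈ Icc 0 (a * T) := fun τ =>
    ⟨le_max_left _ _, max_le haT.le (min_le_right _ _)⟩
  -- the unclamped datum and its transfer to the clamped curve
  have hmod := isModulation_frameG_of_closed E hR hF j hst htR hθ hCb hnear hrate hbudget hpiola hcurv
  have hmodc : IsModulation θ (a * T) nC (fun τ y => frameG E m (s + max 0 (min τ (a * T)) / a) s y) :=
    FrameConj.isModulation_congr_Icc haT.le hmod fun τ hτ => by simp only [FrameConj.clamp_eq_self hτ]; rfl
  -- the window-time Lipschitz constant of the adjugate entries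
  set C : ℝ := 3 * (1 + θ) * Cb with hC
  have hC0 : 0 ≤ C := by rw [hC]; positivity
  have hderiv : ∀ (y : UnitAddTorus (Fin 3)) (i l : Fin 3), ∀ u ∈ Icc 0 T, ∃ D : ℝ, HasDerivWithinAt
      (fun u => (frameJac E m (s + u) s y).adjugate i l) D (Icc 0 T) u ∧ ‖D‖ ≤ C :=
    fun y i l u hu => norm_deriv_adjugate_le_closed E hR hF j hTR hT0 hθ hnear hrate hu y i l
  have hMV : ∀ (y : UnitAddTorus (Fin 3)) (i l : Fin 3), ∀ u₁ ∈ Icc 0 T, ∀ u₂ ∈ Icc 0 T,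
      |(frameJac E m (s + u₂) s y).adjugate i l - (frameJac E m (s + u₁) s y).adjugate i l| ≤ C * |u₂ - u₁| := by
    intro y i l u₁ hu₁ u₂ hu₂
    choose D hD using hderiv y i l
    have h := Convex.norm_image_sub_le_of_norm_hasDerivWithin_le (f := fun u => (frameJac E m (s + u) s y).adjugate i l)
      (f' := fun u => if hu : u ∈ Icc 0 T then D u hu else 0) (s := Icc 0 T) (C := C)
      (fun u hu => by simpa only [dif_pos hu] using (hD u hu).1)
      (fun u hu => by simpa only [dif_pos hu] using (hD u hu).2) (convex_Icc 0 T) hu₁ hu₂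
    simpa only [Real.norm_eq_abs] using h
  have hGadj : ∀ τ ∈ Icc 0 (a * T), ∀ (y : UnitAddTorus (Fin 3)) (i l : Fin 3),
      frameG E m (s + τ / a) s y i l = (frameJac E m (s + τ / a) s y).adjugate i l := by
    intro τ hτ y i l
    rw [FrameConj.frameG_eq_adjugate_closed E hR hF j hTR (hmem τ hτ) y]
  -- `C / a ≤ θ / (a T)`
  have hrate_const : C / a ≤ θ / (a * T) := by
    rw [div_le_div_iff₀ ha0 haT]
    have : C * T ≤ θ := by rw [hC, hTdef]; exact hbudget
    nlinarith [this, ha0.le, hC0]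
  refine { toIsModulation := hmodc, clamped := ?_, rate := ?_, holonomic := ?_ }
  · -- clamped
    intro τ y
    simp only [clamp_clamp τ (a * T) haT.le]
  · -- rate
    intro y i l τ₁ hτ₁ τ₂ hτ₂
    simp only [FrameConj.clamp_eq_self hτ₁, FrameConj.clamp_eq_self hτ₂]
    rw [hGadj τ₁ hτ₁ y i l, hGadj τ₂ hτ₂ y i l]
    have h := hMV y i l (τ₁ / a) (hmem τ₁ hτ₁) (τ₂ / a) (hmem τ₂ hτ₂)
    calc |(frameJac E m (s + τ₂ / a) s y).adjugate i l - (frameJac E m (s + τ₁ / a) s y).adjugate i l|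
        ≤ C * |τ₂ / a - τ₁ / a| := h
      _ = C / a * |τ₂ - τ₁| := by rw [← sub_div, abs_div, abs_of_pos ha0]; ring
      _ ≤ θ / (a * T) * |τ₂ - τ₁| := mul_le_mul_of_nonneg_right hrate_const (abs_nonneg _)
  · -- holonomic: `G * frameJac = 1`, `frameJac = 1 + ∇ disp`
    intro τ hτ
    set t' : ℝ := s + max 0 (min τ (a * T)) / a with ht'
    refine ⟨E.disp m t' s, hR.isSmooth_disp m t' s, fun y => ?_⟩
    have hJ : Matrix.of (fun a' c => (1 : Matrix (Fin 3) (Fin 3) ℝ) a' c + Torus.partialDeriv c (fun z => E.disp m t' s z a') y)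
        = frameJac E m t' s y := by
      ext a' c
      rw [Matrix.of_apply, frameJac, Matrix.of_apply, hR.flowDeriv_single_apply]
    rw [hJ, frameG]
    exact Matrix.nonsing_inv_mul _ ((Matrix.isUnit_iff_isUnit_det _).1 (FrameConj.isUnit_frameJac E hR m t' s y))

/-- **The clamped exact-flow frame is a frame modulation on the CLOSED piece, with a POSITIVE constant** — `Z7Glue.isModulation_frameG_closed_pos`
(p707880) VERBATIM with the conclusion upgraded to `IsFrameModulation` for the clamped curve. -/
theorem isFrameModulation_frameG_closed_pos (k : ℕ) (W : LatticeWord k) : ∃ θs : ℝ, 0 < θs ∧ ∃ Cα : ℝ, 0 < Cα ∧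
    ∀ (E : LagrangianLatticeCarrier k) (θ₀ : ℝ), E.design = W → θ₀ ≤ θs → E.LPermissible → E.Regular →
      (∀ m, E.N m ^ 2 ≤ E.N (m + 1)) → (∀ m, E.θ (m + 1) * ((E.N (m + 1) : ℝ) / E.N m) ^ (1 / 16 : ℝ) ≤ θ₀) →
      ∀ (m : ℕ) (j : ℤ) (t : ℝ), (j : ℝ) * E.refresh (m + 1) < t → t ≤ ((j : ℝ) + 1) * E.refresh (m + 1) → ∀ (nC : ℝ),
        (∀ u ∈ Icc 0 (t - (j : ℝ) * E.refresh (m + 1)), ∀ (y : UnitAddTorus (Fin 3)) (i l c : Fin 3),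
          |Torus.partialDeriv c (fun y => frameG E m ((j : ℝ) * E.refresh (m + 1) + u) ((j : ℝ) * E.refresh (m + 1)) y i l) y|
            ≤ (Cα * E.strain m) * nC) →
        IsFrameModulation (Cα * E.strain m) (E.a (m + 1) * (t - (j : ℝ) * E.refresh (m + 1))) nC
          (fun τ y => frameG E m ((j : ℝ) * E.refresh (m + 1)
            + max 0 (min τ (E.a (m + 1) * (t - (j : ℝ) * E.refresh (m + 1)))) / E.a (m + 1)) ((j : ℝ) * E.refresh (m + 1)) y) := by
  obtain ⟨θ₁, hθ₁, C, hC, Hnear⟩ := abs_frameG_sub_one_le_strain_closed k W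
  obtain ⟨θ₂, hθ₂, C', hC', Hrate⟩ := abs_partialDeriv_partialSum_le k W
  set Cα : ℝ := 5 * C + 6 * C' + 1 with hCα
  have hCα0 : 0 < Cα := by rw [hCα]; positivity
  refine ⟨min (min θ₁ θ₂) (1 / (Cα + 1)), lt_min (lt_min hθ₁ hθ₂) (by positivity), Cα, hCα0, ?_⟩
  intro E θ₀ hD hθs hLP hReg hsq hT4 m j t hst htR nC hcurv
  have hθs₁ : θ₀ ≤ θ₁ := hθs.trans ((min_le_left _ _).trans (min_le_left _ _))
  have hθs₂ : θ₀ ≤ θ₂ := hθs.trans ((min_le_left _ _).trans (min_le_right _ _))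
  have hθs₃ : θ₀ ≤ 1 / (Cα + 1) := hθs.trans (min_le_right _ _)
  have hLR := hReg.levelRegular
  have hF : E.IsFlow m := (hLP.isLagrangian m).1
  set s : ℝ := (j : ℝ) * E.refresh (m + 1) with hs
  set S : ℝ := ∑ i ∈ Finset.range m, E.a (i + 1) with hS
  have hS0 : 0 ≤ S := Finset.sum_nonneg fun i _ => (E.toFractalCarrierData.a_pos _).le
  have hR0 : 0 < E.refresh (m + 1) := E.refresh_pos (m + 1)
  have hTR : t - s ≤ E.refresh (m + 1) := by rw [hs]; linarith
  have hNpos : ∀ m, (0 : ℝ) < E.N m := fun m => by exact_mod_cast E.toFractalCarrierData.N_pos m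
  have hN2 : ∀ m, 2 * E.N m ≤ E.N (m + 1) := hLP.permissible.2.2.1
  have hθm : E.θ (m + 1) ≤ θ₀ := by
    have hNmono : (E.N m : ℝ) ≤ E.N (m + 1) := by
      have h : (2 : ℝ) * E.N m ≤ E.N (m + 1) := by exact_mod_cast hN2 m
      linarith [hNpos m]
    have hr : (1 : ℝ) ≤ ((E.N (m + 1) : ℝ) / E.N m) ^ (1 / 16 : ℝ) :=
      Real.one_le_rpow ((one_le_div (hNpos m)).2 hNmono) (by norm_num)
    calc E.θ (m + 1) = E.θ (m + 1) * 1 := (mul_one _).symm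
      _ ≤ E.θ (m + 1) * ((E.N (m + 1) : ℝ) / E.N m) ^ (1 / 16 : ℝ) := mul_le_mul_of_nonneg_left hr (E.θ_pos _).le
      _ ≤ θ₀ := hT4 m
  have hstrain_def : E.strain m = S * E.refresh (m + 1) := by
    simp [LagrangianLatticeCarrier.strain, hS]
  have hstrain0 : 0 ≤ E.strain m := by rw [hstrain_def]; exact mul_nonneg hS0 hR0.le
  have hstrainθ : E.strain m ≤ θ₀ := (hLP.strain_le m).trans hθm
  have hθle1 : Cα * E.strain m ≤ 1 := by
    have h1 : Cα * θ₀ ≤ Cα * (1 / (Cα + 1)) := mul_le_mul_of_nonneg_left hθs₃ hCα0.le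
    have h2 : Cα * (1 / (Cα + 1)) ≤ 1 := by
      rw [mul_one_div, div_le_one (by positivity)]; linarith
    nlinarith [mul_le_mul_of_nonneg_left hstrainθ hCα0.le]
  have hθ0 : 0 ≤ Cα * E.strain m := mul_nonneg hCα0.le hstrain0
  have hSw : ∀ u ∈ Icc 0 (t - s), S * u ≤ E.strain m := fun u hu => by
    rw [hstrain_def]; exact mul_le_mul_of_nonneg_left (hu.2.trans hTR) hS0
  have hnear : ∀ u ∈ Icc 0 (t - s), ∀ (y : UnitAddTorus (Fin 3)) (i l : Fin 3),
      |frameG E m (s + u) s y i l - (1 : Matrix (Fin 3) (Fin 3) ℝ) i l| ≤ Cα * E.strain m := by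
    intro u hu y i l
    have h := Hnear E θ₀ hD hθs₁ hLP hReg hsq hT4 m j (s + u) (by rw [hs]; linarith [hu.1])
      (by rw [hs]; nlinarith [hu.2, hTR]) y i l
    have h5 : 5 * C * (S * (s + u - (j : ℝ) * E.refresh (m + 1))) ≤ 5 * C * E.strain m := by
      refine mul_le_mul_of_nonneg_left ?_ (by positivity)
      have e : s + u - (j : ℝ) * E.refresh (m + 1) = u := by rw [hs]; ring
      rw [e]; exact hSw u hu
    have h6 : 5 * C * E.strain m ≤ Cα * E.strain m := by
      rw [hCα]; nlinarith [mul_nonneg hC' hstrain0]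
    exact h.trans (h5.trans h6)
  have hrate : ∀ u ∈ Icc 0 (t - s), ∀ (y : UnitAddTorus (Fin 3)) (a q : Fin 3),
      |Torus.partialDeriv q (fun z => E.partialSum m (s + u) z a) (E.X m (s + u) s y)| ≤ C' * S :=
    fun u _ y a q => Hrate E θ₀ hD hθs₂ hLP hReg hsq hT4 m (s + u) _ a q
  have hbudget : 3 * (1 + Cα * E.strain m) * (C' * S) * (t - s) ≤ Cα * E.strain m := by
    have hsw : S * (t - s) ≤ E.strain m := hSw (t - s) ⟨by linarith, le_rfl⟩
    have h1 : 3 * (1 + Cα * E.strain m) * (C' * S) * (t - s) ≤ 6 * C' * (S * (t - s)) := by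
      have : (1 + Cα * E.strain m) ≤ 2 := by linarith
      have hSt : 0 ≤ S * (t - s) := mul_nonneg hS0 (by linarith)
      nlinarith [mul_nonneg hC' hSt]
    have h2 : 6 * C' * (S * (t - s)) ≤ 6 * C' * E.strain m := mul_le_mul_of_nonneg_left hsw (by positivity)
    have h3 : 6 * C' * E.strain m ≤ Cα * E.strain m := by rw [hCα]; nlinarith [mul_nonneg hC hstrain0]
    linarith
  exact isFrameModulation_frameG_of_closed E hLR hF j hst hTR hθ0 (mul_nonneg hC' hS0) hnear hrate hbudget
    (fun u hu i => FrameConj.isDivFree_frameG_col_closed E hLR hF j hTR hu i) hcurv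

end Summit.AnomalousDissipation.AnomalousDissipation.Theorems.SolenoidalFractalHomogenisation.LagrangianStep.FrameForm

end
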